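import Summits.Langlands.Langlands.Theorems.RamifiedCoefficientSeedAdjointLiftingGL3StubInertiaOrderTeichHelpers
import Literature.NumberTheory.GaloisRepresentations.SerreWeightEqTwoShapesProofs
import Literature.NumberTheory.GaloisRepresentations.FundamentalCharacterCyclotomicProofs
import Literature.NumberTheory.GaloisRepresentations.RamificationFiltrationProofs
import Literature.NumberTheory.EllipticCurves.OrdinaryReductionTorsionLineProofs
import Literature.NumberTheory.Automorphic.SerreConjectureProofs
import HarnessLib

/-!
# Crux `AdjointLiftingGL3` (stmt-Langlands-16779), line `birth`, stub S2c — helper 3: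
# the local shape at `p` gives Serre weight `2` for the twist `σ̄ = ω̄^t ⊗ τ₀`

Helper file (theorems only) of stub `stub_weightTwoNewform`.  Input: a continuous
`σ̄ : Γ_ℚ → GL₂(k)` with `σ̄(γ) = ω̄(γ)^t · ιk(τ₀(γ))`, a place `v ∣ p` of `ℚ`, a residue embedding
`ιr` of `ℚ_v = v.adicCompletion ℚ`, and clause (T) of `LocalShapeAt` at `(v, τ₀, ιr, ϖ = p, s)` — a
conjugate of `τ₀|Γ_{ℚ_v}` is `ω^s · (ω ∗; 0 1)` on inertia with `I^u`, `u > 1`, acting trivially,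
or `ω^s · diag(ω₂, ω₂^p)` — with `ω̄^s ω̄^t = 1`.  Output (`exists_serreWeight_eq_two`, the
registered sub-goal of this file): a local restriction datum `loc` at `p` for `σ̄` with
`F = ℚ_v` and `serreWeight p σ̄ loc (ιk ∘ ιr) = 2`.

Proof: on `I_{ℚ_v}`, `ω̄ ∘ res = ψ₁` (`modPCyclotomicCharacterZMod_absGaloisRestrict`, Serre 1972
§1.8 Cor.: `coe_fundamentalCharacter_one_eq_modPCyclotomicCharacter`, `e = 1`), so the twist by
`ω̄^t` cancels the factor `ω^s`; pushing along `ιk` (`coe_fundamentalCharacter_comp`) gives the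
level-one shape `(ψ₁ ∗; 0 1)` = `HasLevelOneInertiaShape _ p _ 1 0`, peu ramifiée (on `I^u`,
`u > 1`, `τ₀ = 1` forces `ω = 1` by the shape identity), resp. — after conjugating by the
transposition matrix — the level-two shape `diag(ψ₂^p, ψ₂)` = `HasLevelTwoInertiaShape _ p _ 0 1`;
then Serre 1987, §2.8 Prop. 3 (`serreWeight_eq_two_of_shape`, `p ≠ 2`).
-/

set_option linter.dupNamespace false -- `Summit.Langlands.Langlands` is the mandated namespace

noncomputable section

namespace Summit.Langlands.Langlands.Cruxes.AdjointLiftingGL3.Birth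

open scoped MatrixGroups NumberField
open NumberField IsDedekindDomain Field Filter ValuativeRel
open Literature.NumberTheory.GaloisRepresentations Literature.NumberTheory.PAdicHodge
open Literature.NumberTheory.Automorphic
open Literature.NumberTheory.GaloisRepresentations.IsNonarchimedeanLocalField
open Literature.NumberTheory.GaloisRepresentations.ModPGaloisRep

/-! ## Fundamental characters along a composite residue embedding -/

/-- **`ψ_m` along `ιk ∘ ιr` is `ιk ∘ ψ_m` along `ιr`** (the fundamental character is `ι` applied to
the Kummer cocycle modulo `𝔓`, `coe_kummerCharacter_apply`). [folklore] -/
theorem coe_fundamentalCharacter_comp {F : Type*} [Field F] [ValuativeRel F] [TopologicalSpace F]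
    [IsNonarchimedeanLocalField F] {k₀ k : Type*} [Field k₀] [Field k]
    (ιr : absIntegers 𝒪[F] F ⧸ absMaximalIdeal F →+* k₀) (ιk : k₀ →+* k) (m : ℕ) (ϖ : 𝒪[F])
    (hϖ : Irreducible ϖ) (σ : absInertia F) :
    ((fundamentalCharacter F m (ιk.comp ιr) ϖ hϖ σ : kˣ) : k) =
      ιk ((fundamentalCharacter F m ιr ϖ hϖ σ : k₀ˣ) : k₀) := by
  by_cases hm : m = 0
  · subst hm
    rw [fundamentalCharacter, dif_pos rfl, fundamentalCharacter, dif_pos rfl, MonoidHom.one_apply,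
      MonoidHom.one_apply, Units.val_one, Units.val_one, map_one]
  · rw [fundamentalCharacter_of_ne_zero F hm, fundamentalCharacter_of_ne_zero F hm,
      coe_kummerCharacter_apply, coe_kummerCharacter_apply, RingHom.comp_apply]

/-! ## The local shape gives Serre weight `2` for the twist -/

/-- **Serre weight `2` for `σ̄ = ω̄^t ⊗ τ₀` from the local shape of `τ₀` at `p`** (registered
sub-goal of this helper file).  Let `p ≠ 2`, `k` a discrete field of characteristic `p`,
`ιk : ℤ̄_p/𝔪 → k`, `s, t` with `u^s u^t = 1` on `(ℤ/p)ˣ`, `σ̄ : Γ_ℚ → GL₂(k)` continuous with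
`σ̄(γ) = ω̄(γ)^t · ιk(τ₀ γ)`, `v ∣ p` a place of `ℚ` with residue embedding `ιr` of `ℚ_v` and
`p` a uniformiser of `ℚ_v`.  If a conjugate of `τ₀ ∘ res` is `ω^s · (ω ∗; 0 1)` on `I_{ℚ_v}` with
`τ₀ ∘ res` trivial on the `I^u`, `u > 1`, or is `ω^s · diag(ω₂, ω₂^p)` (`ω = ψ₁`, `ω₂ = ψ₂` the
fundamental characters for `(ιr, p)`), then for the local restriction datum `loc = (ℚ_v, σ̄|Γ_{ℚ_v})`
and the residue embedding `ιk ∘ ιr`, `serreWeight p σ̄ loc (ιk ∘ ιr) = 2`.  Proof: `ω̄ ∘ res = ψ₁` on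
inertia (Serre 1972, §1.8 Cor., `coe_fundamentalCharacter_one_eq_modPCyclotomicCharacter`;
`modPCyclotomicCharacterZMod_absGaloisRestrict`), so the twist cancels `ω^s`, leaving the shapes
(2.8.2) peu ramifiée, resp. (2.8.1) after the transposition of the basis; Serre 1987, §2.8 Prop. 3
(`serreWeight_eq_two_of_shape`). [cite: Serre1987, §2.8 Prop. 3] [cite: SerreInventiones1972, §1.8 Cor.] -/
theorem exists_serreWeight_eq_two :
    ∀ (p : ℕ) [Fact p.Prime], p ≠ 2 →
      ∀ (k : Type) [Field k] [CharP k p] [TopologicalSpace k] [DiscreteTopology k]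
        (ιk : padicAlgClResidueField p →+* k) (s t : ℕ), (∀ u : (ZMod p)ˣ, u ^ s * u ^ t = 1) →
        ∀ (τ₀ : absoluteGaloisGroup ℚ →* GL (Fin 2) (padicAlgClResidueField p))
          (σb : ModPGaloisRep ℚ k 2),
          (∀ γ, ((σb γ : GL (Fin 2) k) : Matrix (Fin 2) (Fin 2) k) =
            ((ZMod.castHom (dvd_refl p) k (((omegaModP p γ) ^ t : (ZMod p)ˣ) : ZMod p)) •
              ((τ₀ γ : GL (Fin 2) (padicAlgClResidueField p)) :
                Matrix (Fin 2) (Fin 2) (padicAlgClResidueField p)).map ιk)) →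
          ∀ (v : HeightOneSpectrum (𝓞 ℚ)), ((p : ℕ) : 𝓞 ℚ) ∈ v.asIdeal →
          ∀ (ιr : absIntegers 𝒪[v.adicCompletion ℚ] (v.adicCompletion ℚ) ⧸
                absMaximalIdeal (v.adicCompletion ℚ) →+* padicAlgClResidueField p)
            (hϖ : Irreducible ((p : ℕ) : 𝒪[v.adicCompletion ℚ])),
            ((∃ P : GL (Fin 2) (padicAlgClResidueField p),
                (∀ σ : ↥(absInertia (v.adicCompletion ℚ)), ∃ c : padicAlgClResidueField p,
                  ((P * τ₀ (absGaloisRestrict ℚ (v.adicCompletion ℚ) (σ : absoluteGaloisGroup _)) * P⁻¹ :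
                      GL (Fin 2) (padicAlgClResidueField p)) : Matrix (Fin 2) (Fin 2) _) =
                    (((fundamentalCharacter (v.adicCompletion ℚ) 1 ιr _ hϖ σ) ^ s :
                        (padicAlgClResidueField p)ˣ) : padicAlgClResidueField p) •
                      !![(((fundamentalCharacter (v.adicCompletion ℚ) 1 ιr _ hϖ σ) :
                          (padicAlgClResidueField p)ˣ) : padicAlgClResidueField p), c;
                        0, 1]) ∧
                ∀ u : ℝ, 1 < u → ∀ σ ∈ absUpperInertia (v.adicCompletion ℚ) u,
                  τ₀ (absGaloisRestrict ℚ (v.adicCompletion ℚ) σ) = 1) ∨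
            (∃ P : GL (Fin 2) (padicAlgClResidueField p),
                ∀ σ : ↥(absInertia (v.adicCompletion ℚ)),
                  ((P * τ₀ (absGaloisRestrict ℚ (v.adicCompletion ℚ) (σ : absoluteGaloisGroup _)) * P⁻¹ :
                      GL (Fin 2) (padicAlgClResidueField p)) : Matrix (Fin 2) (Fin 2) _) =
                    (((fundamentalCharacter (v.adicCompletion ℚ) 1 ιr _ hϖ σ) ^ s :
                        (padicAlgClResidueField p)ˣ) : padicAlgClResidueField p) •
                      !![(((fundamentalCharacter (v.adicCompletion ℚ) 2 ιr _ hϖ σ) :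
                          (padicAlgClResidueField p)ˣ) : padicAlgClResidueField p), 0;
                        0, (((fundamentalCharacter (v.adicCompletion ℚ) 2 ιr _ hϖ σ) ^ p :
                          (padicAlgClResidueField p)ˣ) : padicAlgClResidueField p)])) →
            ∃ (loc : LocalRestrictionAt p σb)
              (ι' : absIntegers 𝒪[loc.F] loc.F ⧸ absMaximalIdeal loc.F →+* k),
              serreWeight p σb loc ι' = 2 := by
  intro p _ hp2 k _ _ _ _ ιk s t hst τ₀ σb hσb v hv ιr hϖ hT
  classical
  haveI := charP_padicAlgClResidueField p
  have hq : residueFieldCard (v.adicCompletion ℚ) = p :=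
    residueFieldCard_adicCompletion_eq_of_mem Fact.out hv
  haveI : NeZero ((p : ℕ) : v.adicCompletion ℚ) := neZero_natCast_of_irreducible hϖ
  -- the local representation `σ̄|Γ_{ℚ_v}` and the datum
  let rep : ModPGaloisRep (v.adicCompletion ℚ) k 2 :=
    FramedGaloisRep.restrictField (v.adicCompletion ℚ) σb
  have hrep : ∀ σ : absoluteGaloisGroup (v.adicCompletion ℚ),
      rep σ = σb (absGaloisRestrict ℚ (v.adicCompletion ℚ) σ) := fun _ => rfl
  let loc : LocalRestrictionAt p σb :=
    { F := v.adicCompletion ℚ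
      residueFieldCard_eq := hq
      irreducible_natCast := hϖ
      rep := rep
      rep_eq_restrictField := rfl }
  -- (B) on inertia `ω̄ ∘ res = ψ₁`, pushed into `k`
  have hB : ∀ σ : absInertia (v.adicCompletion ℚ),
      ZMod.castHom (dvd_refl p) k
        ((omegaModP p (absGaloisRestrict ℚ (v.adicCompletion ℚ) (σ : absoluteGaloisGroup _)) :
          (ZMod p)ˣ) : ZMod p) =
      ιk ((fundamentalCharacter (v.adicCompletion ℚ) 1 ιr _ hϖ σ : (padicAlgClResidueField p)ˣ) :
        padicAlgClResidueField p) := fun σ => by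
    rw [← coe_fundamentalCharacter_comp,
      coe_fundamentalCharacter_one_eq_modPCyclotomicCharacter hϖ hq (ιk.comp ιr)
        (ZMod.castHom (dvd_refl p) k) σ, coe_modPCyclotomicCharacter_apply,
      ← modPCyclotomicCharacterZMod_absGaloisRestrict ℚ (v.adicCompletion ℚ) p]
    rfl
  -- the twist cancels `ω^s`
  have hunit : ∀ σ : absInertia (v.adicCompletion ℚ),
      ZMod.castHom (dvd_refl p) k
          (((omegaModP p (absGaloisRestrict ℚ (v.adicCompletion ℚ) (σ : absoluteGaloisGroup _))) ^ t :
            (ZMod p)ˣ) : ZMod p) *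
        ιk (((fundamentalCharacter (v.adicCompletion ℚ) 1 ιr _ hϖ σ) ^ s :
          (padicAlgClResidueField p)ˣ) : padicAlgClResidueField p) = 1 := fun σ => by
    rw [Units.val_pow_eq_pow_val, Units.val_pow_eq_pow_val, map_pow, map_pow, ← hB σ, ← pow_add,
      ← map_pow, add_comm, pow_add, ← Units.val_pow_eq_pow_val, ← Units.val_pow_eq_pow_val,
      ← Units.val_mul, hst, Units.val_one, map_one]
  -- conjugation transport along `ιk`
  have hmapP : ∀ P : GL (Fin 2) (padicAlgClResidueField p),
      ((Matrix.GeneralLinearGroup.map ιk P : GL (Fin 2) k) : Matrix (Fin 2) (Fin 2) k) =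
        (P : Matrix (Fin 2) (Fin 2) (padicAlgClResidueField p)).map ιk := fun _ => rfl
  have htrans : ∀ (P : GL (Fin 2) (padicAlgClResidueField p)) (σ : absInertia (v.adicCompletion ℚ))
      (A : Matrix (Fin 2) (Fin 2) (padicAlgClResidueField p)),
      ((P * τ₀ (absGaloisRestrict ℚ (v.adicCompletion ℚ) (σ : absoluteGaloisGroup _)) * P⁻¹ :
          GL (Fin 2) (padicAlgClResidueField p)) : Matrix (Fin 2) (Fin 2) _) =
        (((fundamentalCharacter (v.adicCompletion ℚ) 1 ιr _ hϖ σ) ^ s :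
            (padicAlgClResidueField p)ˣ) : padicAlgClResidueField p) • A →
      ((Matrix.GeneralLinearGroup.map ιk P * rep (σ : absoluteGaloisGroup _) *
          (Matrix.GeneralLinearGroup.map ιk P)⁻¹ : GL (Fin 2) k) : Matrix (Fin 2) (Fin 2) k) =
        A.map ιk := by
    intro P σ A hA
    rw [Units.val_mul, Units.val_mul, ← map_inv, hmapP, hmapP, hrep, hσb, Matrix.mul_smul,
      Matrix.smul_mul, ← Matrix.map_mul, ← Matrix.map_mul, ← Units.val_mul, ← Units.val_mul, hA,
      Matrix.map_smul' _ _ _ (map_mul ιk), smul_smul, hunit σ, one_smul]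
  have hmap2 : ∀ (a b c d : padicAlgClResidueField p),
      (!![a, b; c, d] : Matrix (Fin 2) (Fin 2) (padicAlgClResidueField p)).map ιk =
        !![ιk a, ιk b; ιk c, ιk d] := fun a b c d => by
    ext i j
    fin_cases i <;> fin_cases j <;> rfl
  -- the shape of `rep` on inertia
  have hshape : rep.HasLevelTwoInertiaShape (ιk.comp ιr) ((p : ℕ) : 𝒪[v.adicCompletion ℚ]) hϖ 0 1 ∨
      (rep.HasLevelOneInertiaShape (ιk.comp ιr) ((p : ℕ) : 𝒪[v.adicCompletion ℚ]) hϖ 1 0 ∧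
        (rep.IsTamelyRamified ∨ rep.IsPeuRamifie)) := by
    rcases hT with ⟨P, hP, htriv⟩ | ⟨P, hP⟩
    · -- level one, peu ramifiée
      refine Or.inr ⟨⟨Matrix.GeneralLinearGroup.map ιk P, fun σ => ?_⟩, Or.inr ?_⟩
      · obtain ⟨c, hc⟩ := hP σ
        refine ⟨ιk c, ?_⟩
        rw [htrans P σ _ hc, hmap2, pow_one, pow_zero, Units.val_one, coe_fundamentalCharacter_comp,
          map_zero, map_one]
      · intro u hu σ hσ
        have hσI : σ ∈ absInertia (v.adicCompletion ℚ) :=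
          absUpperInertia_le_absInertia_holds (v.adicCompletion ℚ) u hσ
        have h1 : τ₀ (absGaloisRestrict ℚ (v.adicCompletion ℚ) σ) = 1 := htriv u hu σ hσ
        obtain ⟨c, hc⟩ := hP ⟨σ, hσI⟩
        have e1 : ((P * τ₀ (absGaloisRestrict ℚ (v.adicCompletion ℚ)
            ((⟨σ, hσI⟩ : absInertia (v.adicCompletion ℚ)) : absoluteGaloisGroup _)) * P⁻¹ :
            GL (Fin 2) (padicAlgClResidueField p)) :
              Matrix (Fin 2) (Fin 2) (padicAlgClResidueField p)) = 1 := by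
          have h1' : τ₀ (absGaloisRestrict ℚ (v.adicCompletion ℚ)
              ((⟨σ, hσI⟩ : absInertia (v.adicCompletion ℚ)) : absoluteGaloisGroup _)) = 1 := h1
          rw [h1', mul_one, mul_inv_cancel, Units.val_one]
        have hc' := hc
        rw [e1] at hc'
        have h11 := congrFun (congrFun hc' 1) 1
        have h00 := congrFun (congrFun hc' 0) 0
        simp only [Matrix.one_apply_eq, Matrix.smul_apply, Matrix.of_apply, Matrix.cons_val',
          Matrix.cons_val_zero, Matrix.cons_val_one, Matrix.empty_val', Matrix.cons_val_fin_one,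
          smul_eq_mul, mul_one] at h11 h00
        have hy : ((fundamentalCharacter (v.adicCompletion ℚ) 1 ιr _ hϖ ⟨σ, hσI⟩ :
            (padicAlgClResidueField p)ˣ) : padicAlgClResidueField p) = 1 := by
          rw [← h11, one_mul] at h00
          exact h00.symm
        have hω : omegaModP p (absGaloisRestrict ℚ (v.adicCompletion ℚ) σ) = 1 := by
          have hBσ := hB ⟨σ, hσI⟩
          rw [hy, map_one] at hBσ
          have h2 : ((omegaModP p (absGaloisRestrict ℚ (v.adicCompletion ℚ) σ) : (ZMod p)ˣ) :
              ZMod p) = 1 :=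
            (ZMod.castHom (dvd_refl p) k).injective (by rw [map_one]; exact hBσ)
          exact Units.ext h2
        rw [hrep]
        apply Units.ext
        rw [hσb, h1, hω, one_pow, Units.val_one, map_one, one_smul, Units.val_one,
          Matrix.map_one _ (map_zero ιk) (map_one ιk), Units.val_one]
    · -- level two, after the transposition of the basis
      let W : GL (Fin 2) k :=
        ⟨!![0, 1; 1, 0], !![0, 1; 1, 0],
          by rw [Matrix.mul_fin_two, Matrix.one_fin_two]; simp,
          by rw [Matrix.mul_fin_two, Matrix.one_fin_two]; simp⟩
      have hW : ((W : GL (Fin 2) k) : Matrix (Fin 2) (Fin 2) k) = !![0, 1; 1, 0] := rfl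
      have hWi : ((W⁻¹ : GL (Fin 2) k) : Matrix (Fin 2) (Fin 2) k) = !![0, 1; 1, 0] := rfl
      refine Or.inl ⟨W * Matrix.GeneralLinearGroup.map ιk P, fun σ => ?_⟩
      have hinner := htrans P σ _ (hP σ)
      rw [hmap2, map_zero] at hinner
      have e : W * Matrix.GeneralLinearGroup.map ιk P * rep (σ : absoluteGaloisGroup _) *
          (W * Matrix.GeneralLinearGroup.map ιk P)⁻¹ =
          W * (Matrix.GeneralLinearGroup.map ιk P * rep (σ : absoluteGaloisGroup _) *
            (Matrix.GeneralLinearGroup.map ιk P)⁻¹) * W⁻¹ := by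
        group
      rw [e, Units.val_mul, Units.val_mul, hinner, hW, hWi]
      simp only [Matrix.mul_fin_two, mul_one, mul_zero, zero_add, add_zero, one_mul, zero_mul, hq,
        Units.val_pow_eq_pow_val, coe_fundamentalCharacter_comp, map_pow, pow_one]
  exact ⟨loc, ιk.comp ιr, serreWeight_eq_two_of_shape loc (ιk.comp ιr) hp2 hshape⟩

end Summit.Langlands.Langlands.Cruxes.AdjointLiftingGL3.Birth

end
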